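import Summits.QuantumFields.YangMills.Theorems.BalabanUVNodesN15CovariantAveragingSandwichSizes
import Summits.QuantumFields.YangMills.Theorems.BalabanUVNodesN15TwoSpacingGluingCurvedKnitCovariantAveragingDefectRows
import HarnessLib

/-!
# N15 (NE2), PROGRAMME Q, part (Q-6b): THE TWO COMPARISON ROWS OF THE CONSTRUCTED COVARIANT AVERAGING AND THE WHOLE `hfam`

dag-n15-a g31, KNIT-BY-NAME seat, node N15 = NE2. HONEST LABEL: by-name bookkeeping on MODEL carriers (dag-n15-c's two-spacing glued
torus `cvM`, bond carriers `CvX ∕ CvX′`, the instance `sfInstance`); the rows below are estimates about dag-n15-c's KERNEL-DEFINED covariant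
block averaging `CovAvg.qvCov ∕ qvCovAdj` ([5] (124)–(125) shape) and NOT [B9] (3.78)–(3.81) ∕ Thms 3.1 ∕ 3.2 ∕ 3.15 AS PRINTED. N15 stays
DISCHARGED OF RECORD 8∕28 AS CONSUMED on p687738; nothing here re-claims it; no count.

WHAT.  (Q-6a) (`…CovariantAveragingSandwichSizes`) built the perturbation family `D_c, E_c, D_f, E_f` (`qDc, qEc, qDf, qEf`:
`Q_{T(A′)} − Q ⊗ 1_ι` and adjoints, coarse at `L^{kk}` with the block-mean field `Ā′ = gavgM π̂ A′`, fine at `L^r·L^{kk}` with `A′`) and proved the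
four SIZE rows of (Q-3)'s displayed hypothesis `hfam`.  This file proves the two remaining COMPARISON rows

  `D_f(A′)∘P̂ − D_c(A′) ≤ K_C(ρ)·(c₃₅L^mα₀)·L^{−kk}·e^{−ρd}`   (`hasMaj_qDf_pull_sub_qDc`, coarse coloured 1-forms → unit lattice),
  `E_f(A′) − P̂∘E_c(A′) ≤ K_C(ρ)·(c₃₅L^mα₀)·L^{−kk}·e^{−ρd}`   (`hasMaj_qEf_sub_pull_qEc`, unit lattice → fine coloured 1-forms),

by name from dag-n15-c's two-grid comparison of kernel averages (184a∕184b `CovAvg.hasMaj_qvKer_twoGrid` ∕ `hasMaj_qvAdjKer_twoGrid`), their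
transport sizes (`rows∕cols_cvaPath_sub_one_le`), the path-holonomy fit at two spacings (185c `CovAvg.norm_holPath_two_grid_le`) and 187b's
fit feeders (`Gluing.cv_fit_of_hol` ∕ `cv_fitA_of_hol`), and then assembles ★★★ `qvCov_rows_sf`: the WHOLE `hfam` of (Q-3)∕(Q-4)∕(Q-5)∕(∂-2)§3
for the constructed family, with `K_D := max (K_Q ρ) (K_C ρ)` INDEPENDENT of the index `i` and the window `s₀ := 1` (`c₃₅L^mα₀ ≤ 1`).
(Q-6c) instantiates the four family-parametric knits by `exact`.

§1 scalar: `cHol` and `hol_rhs_le` (185c's explicit right-hand side is `≤ cHol(d)·r_A·L^{−k}`).  §2 `hol_fit`: the holonomy fit of the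
family under `Reg335` (Frobenius currency bridged to 185c's operator norm by (Q-6a)'s `l2_opNorm_le_frobeniusNorm`).  §3 `kC`, the two rows.
§4 `qvCov_rows_sf`.

References: [5] T. Balaban, Averaging operations for lattice gauge theories, CMP 98 (1985) 17–51, (124)–(126) p.36.
[B9] T. Balaban, Propagators for lattice gauge theories in a background field, CMP 99 (1985) 389–434, (3.73) p.405, (3.80)–(3.81) p.406.
[King1986] C. King, The U(1) Higgs model. I. The continuum limit, CMP 102 (1986) 649–677, Prop. 3.9 (3.73) p.665 (two-grid comparison shape)
(v1.0.1: volume∕pages of the King citation corrected — ref-B READ-1009 NIT; no declaration changed).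
-/

open scoped BigOperators Matrix

namespace Summit.QuantumFields.YangMills.BalabanUVNodes.N15.SiteLayerSf

open Literature.MathematicalPhysics.QuantumFieldTheory.Balaban1983to89
open Literature.MathematicalPhysics.QuantumFieldTheory.Balaban1983to89.B11SectG (BlockNorm HasMaj)
open Literature.MathematicalPhysics.QuantumFieldTheory.Balaban1983to89.B5Prop11Plancherel (Tor fine unitVec)
open Literature.MathematicalPhysics.QuantumFieldTheory.Balaban1983to89.B6UnitTorusCarrier (unitTorusGeo unitTorusGeo_dist_nonneg)
open Literature.MathematicalPhysics.QuantumFieldTheory.Balaban1983to89.T4EtaRateCoeffDefect (pull)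
open Literature.MathematicalPhysics.QuantumFieldTheory.King1986.Torus (blockOf tdistT)
open Summit.QuantumFields.YangMills.BalabanUVNodes.N15.BackgroundLayer (gavgM)
open Summit.QuantumFields.YangMills.BalabanUVNodes.N15.VectorPiece (bshiftEquiv kingPr kingPrV tensorId)
open Summit.QuantumFields.YangMills.BalabanUVNodes.N15.MatrixSpecies (basisConst basisConst_nonneg liftBlk liftMap norm_blockAvgV_le)
open Summit.QuantumFields.YangMills.BalabanUVNodes.N15.TwoGrid (qvRe qvAdjRe)
open Summit.QuantumFields.YangMills.BalabanUVNodes.N15.Gluing (SfIdx sfInstance sfInstance_reg335_iff CvX CvX' cvM cvBlk CvNorm cvT sf_rows_cvT_exp_sub_one_le sf_cols_cvT_exp_sub_one_le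
  gavgM_conjTranspose_of_skew MP_succ_eq cv_fit_of_hol cv_fitA_of_hol)
open Summit.QuantumFields.YangMills.BalabanUVNodes.N15.CovAvg (qvCov qvCovAdj cvaPath qvKer qvAdjKer holPath qvCov_sub_qvCov_one qvCovAdj_sub_qvCovAdj_one hasMaj_qvKer_twoGrid
  hasMaj_qvAdjKer_twoGrid rows_cvaPath_sub_one_le cols_cvaPath_sub_one_le norm_holPath_two_grid_le)
open Summit.QuantumFields.YangMills.BalabanUVNodes.N15.CurvedSpecies (exp_smul_unitary_of_conjTranspose)

/-! ## §1 Scalar letters: 185c's right-hand side is `O(r_A·L^{−k})` -/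

section Scalar

/-- The holonomy-fit constant `C_hol(d) = 3^{d+1}(d+1)(72(d+1) + 9) + 2 + 2e + 2(d+1)e²` (185c's right-hand side divided by `r_A L^{−k}`). [bookkeeping] -/
noncomputable def cHol (d : ℕ) : ℝ := 3 ^ (d + 1) * ((d + 1 : ℝ) * (72 * (d + 1 : ℝ) + 9)) + (2 + 2 * Real.exp 1 + 2 * (d + 1 : ℝ) * Real.exp 1 * Real.exp 1)

/-- `0 ≤ C_hol`. [bookkeeping] -/
theorem cHol_nonneg (d : ℕ) : 0 ≤ cHol d := by unfold cHol; positivity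

/-- 185c's right-hand side in abstract letters (`n′ = ab`, `a, b ≥ 1`, `N ≤ 2(d+1)a`) is `≤ C_hol(d)·r_A·b⁻¹`. [folklore] -/
theorem hol_rhs_le_aux {d : ℕ} {n' a b N rA : ℝ} (hn : n' = a * b) (ha : 1 ≤ a) (hb : 1 ≤ b) (hN : N ≤ 2 * (d + 1 : ℝ) * a) (hrA : 0 ≤ rA) :
    3 ^ (d + 1) * ((d + 1) * (36 * n' * (n'⁻¹ * (N * (rA * n'⁻¹))) + 9 * (a * (n'⁻¹ * rA)))) +
      (2 * (rA * b⁻¹) + 2 * (rA * b⁻¹) * Real.exp 1 + Real.exp 1 * (N * (rA * n'⁻¹)) * Real.exp 1) ≤ cHol d * (rA * b⁻¹) := by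
  have ha0 : a ≠ 0 := by positivity
  have hb0 : 0 < b := by positivity
  have hn0 : n' ≠ 0 := by rw [hn]; positivity
  have e1 : 36 * n' * (n'⁻¹ * (N * (rA * n'⁻¹))) = 36 * (N * (rA * n'⁻¹)) := by
    calc 36 * n' * (n'⁻¹ * (N * (rA * n'⁻¹))) = 36 * (n' * n'⁻¹) * (N * (rA * n'⁻¹)) := by ring
      _ = _ := by rw [mul_inv_cancel₀ hn0, mul_one]
  have e2 : a * (n'⁻¹ * rA) = rA * b⁻¹ := by
    rw [hn, mul_inv]
    calc a * (a⁻¹ * b⁻¹ * rA) = (a * a⁻¹) * (rA * b⁻¹) := by ring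
      _ = _ := by rw [mul_inv_cancel₀ ha0, one_mul]
  have e3 : N * (rA * n'⁻¹) ≤ 2 * (d + 1 : ℝ) * (rA * b⁻¹) := by
    rw [hn, mul_inv]
    calc N * (rA * (a⁻¹ * b⁻¹)) ≤ (2 * (d + 1 : ℝ) * a) * (rA * (a⁻¹ * b⁻¹)) := mul_le_mul_of_nonneg_right hN (by positivity)
      _ = 2 * (d + 1 : ℝ) * (a * a⁻¹) * (rA * b⁻¹) := by ring
      _ = _ := by rw [mul_inv_cancel₀ ha0, mul_one]
  rw [e1, e2]
  have hq : 0 ≤ rA * b⁻¹ := by positivity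
  calc 3 ^ (d + 1) * ((d + 1) * (36 * (N * (rA * n'⁻¹)) + 9 * (rA * b⁻¹))) + (2 * (rA * b⁻¹) + 2 * (rA * b⁻¹) * Real.exp 1 + Real.exp 1 * (N * (rA * n'⁻¹)) * Real.exp 1)
      ≤ 3 ^ (d + 1) * ((d + 1) * (36 * (2 * (d + 1 : ℝ) * (rA * b⁻¹)) + 9 * (rA * b⁻¹))) +
          (2 * (rA * b⁻¹) + 2 * (rA * b⁻¹) * Real.exp 1 + Real.exp 1 * (2 * (d + 1 : ℝ) * (rA * b⁻¹)) * Real.exp 1) := by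
        gcongr
    _ = cHol d * (rA * b⁻¹) := by unfold cHol; ring

/-- 185c's right-hand side at `n′ = L^m·L^k` is `≤ C_hol(d)·r_A·L^{−k}`. [folklore] -/
theorem hol_rhs_le {L : ℕ} (hL : 0 < L) (m k d : ℕ) {rA : ℝ} (hrA : 0 ≤ rA) :
    3 ^ (d + 1) * ((d + 1) * (36 * ((L ^ m * L ^ k : ℕ) : ℝ) * (((((L ^ m * L ^ k : ℕ) : ℝ))⁻¹) * ((2 * ((d + 1) * (L ^ m - 1)) : ℕ) * (rA * ((((L ^ m * L ^ k : ℕ) : ℝ))⁻¹)))) +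
        9 * (((L ^ m : ℕ) : ℝ) * (((((L ^ m * L ^ k : ℕ) : ℝ))⁻¹) * rA)))) +
      (2 * (rA * ((((L ^ k : ℕ) : ℝ))⁻¹)) + 2 * (rA * ((((L ^ k : ℕ) : ℝ))⁻¹)) * Real.exp 1 +
        Real.exp 1 * ((2 * ((d + 1) * (L ^ m - 1)) : ℕ) * (rA * ((((L ^ m * L ^ k : ℕ) : ℝ))⁻¹))) * Real.exp 1) ≤
      cHol d * (rA * ((((L ^ k : ℕ) : ℝ))⁻¹)) := by
  have ha : (1 : ℝ) ≤ ((L ^ m : ℕ) : ℝ) := by exact_mod_cast Nat.one_le_pow _ _ hL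
  have hb : (1 : ℝ) ≤ ((L ^ k : ℕ) : ℝ) := by exact_mod_cast Nat.one_le_pow _ _ hL
  have hN : (((2 * ((d + 1) * (L ^ m - 1))) : ℕ) : ℝ) ≤ 2 * (d + 1 : ℝ) * ((L ^ m : ℕ) : ℝ) := by
    have h : 2 * ((d + 1) * (L ^ m - 1)) ≤ 2 * ((d + 1) * L ^ m) := Nat.mul_le_mul_left 2 (Nat.mul_le_mul_left _ (Nat.sub_le _ _))
    calc (((2 * ((d + 1) * (L ^ m - 1))) : ℕ) : ℝ) ≤ ((2 * ((d + 1) * L ^ m) : ℕ) : ℝ) := by exact_mod_cast h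
      _ = 2 * (d + 1 : ℝ) * ((L ^ m : ℕ) : ℝ) := by push_cast; ring
  exact hol_rhs_le_aux (by push_cast; ring) ha hb hN hrA

end Scalar

variable (d : ℕ) {L : ℕ} [NeZero L] (mm ι : Type) [Fintype mm] [DecidableEq mm] [Fintype ι] [DecidableEq ι] (e : Matrix mm mm ℂ ≃L[ℝ] (ι → ℝ))

/-! ## §2 The holonomy fit of the family under `Reg335` -/

section HolFit

open scoped Matrix.Norms.L2Operator

variable [Nonempty mm]

omit [DecidableEq ι] in
/-- ★ **THE PATH HOLONOMIES OF THE FINE FIELD AND OF ITS BLOCK MEAN FIT ALONG KING'S PAIRING**: under `Reg335 c₃₅ α₀ A′` (dag-n15-c's FROBENIUS class) with `c₃₅L^mα₀ ≤ 1`,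
`‖hol′(x′, L^r s + j) − hol(πx′, s + δ′)‖ ≤ C_hol(d)·(c₃₅L^mα₀)·L^{−kk}` whenever `π(x′ + je′) = πx′ + δ′e`, `s < L^{kk}`, `j < L^r`, `δ′ ≤ 1` — 185c by name, its operator-norm
letters fed from the Frobenius class through (Q-6a)'s bridge, its torus-size side condition from `M_ν = 2L·L^m`. [cite: Balaban1985BackgroundPropagators, (3.73) p.405 (shape)] -/
theorem hol_fit (hL : Odd L ∧ 1 < L) (i : SfIdx d L) {c35 α₀ : ℝ} (hc35 : 0 ≤ c35) (hα₀ : 0 < α₀) (hr1 : c35 * (L : ℝ) ^ i.m * α₀ ≤ 1)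
    {A' : Fin (d + 1) → CvX' d L i.m i.kk i.r hL → Matrix mm mm ℂ} (hA' : (sfInstance d mm ι hL i).Bf.Reg335 c35 α₀ A')
    (x' : Tor (fine (L ^ i.r * L ^ i.kk) (cvM d L i.m i.kk hL))) (μ : Fin (d + 1)) (s j δ' : ℕ) (hs : s < L ^ i.kk) (hj : j < L ^ i.r) (hδ' : δ' ≤ 1)
    (hπ : kingPr L i.kk i.r (cvM d L i.m i.kk hL) (x' + j • unitVec (fine (L ^ i.r * L ^ i.kk) (cvM d L i.m i.kk hL)) μ) =
      kingPr L i.kk i.r (cvM d L i.m i.kk hL) x' + δ' • unitVec (fine (L ^ i.kk) (cvM d L i.m i.kk hL)) μ) :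
    ‖holPath (cvM d L i.m i.kk hL) (L ^ i.r * L ^ i.kk) (fun μ b => NormedSpace.exp (((((L ^ i.r * L ^ i.kk : ℕ) : ℝ))⁻¹) • A' μ b)) (x', μ) (L ^ i.r * s + j) -
        holPath (cvM d L i.m i.kk hL) (L ^ i.kk)
          (fun μ b => NormedSpace.exp (((((L ^ i.kk : ℕ) : ℝ))⁻¹) • gavgM (Matrix mm mm ℂ) (Fin (d + 1)) (kingPrV L i.kk i.r (cvM d L i.m i.kk hL)) A' μ b))
          (kingPr L i.kk i.r (cvM d L i.m i.kk hL) x', μ) (s + δ')‖ ≤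
      cHol d * ((c35 * (L : ℝ) ^ i.m * α₀) * ((((L ^ i.kk : ℕ) : ℝ))⁻¹)) := by
  have hLpos : 0 < L := Nat.pos_of_ne_zero (NeZero.ne L)
  obtain ⟨hskew, h1, h2, -⟩ := (sfInstance_reg335_iff d mm ι hL i c35 α₀ A').1 hA'
  have hrA0 : 0 ≤ c35 * (L : ℝ) ^ i.m * α₀ := by positivity
  have hAop : ∀ μ b', ‖A' μ b'‖ ≤ c35 * (L : ℝ) ^ i.m * α₀ := fun μ b' => (l2_opNorm_le_frobeniusNorm _).trans (h1 μ b')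
  have hconv : c35 * (L : ℝ) ^ i.m * α₀ * (((L : ℝ) ^ i.kk)⁻¹ * ((L : ℝ) ^ i.r)⁻¹) = (c35 * (L : ℝ) ^ i.m * α₀) * ((((L ^ i.r * L ^ i.kk : ℕ) : ℝ))⁻¹) := by
    push_cast; ring
  have hstep : ∀ μ κ b', ‖A' μ (bshiftEquiv (cvM d L i.m i.kk hL) (L ^ i.r * L ^ i.kk) κ b') - A' μ b'‖ ≤ (c35 * (L : ℝ) ^ i.m * α₀) * ((((L ^ i.r * L ^ i.kk : ℕ) : ℝ))⁻¹) :=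
    fun μ κ b' => (l2_opNorm_le_frobeniusNorm _).trans ((h2 μ κ b').trans_eq hconv)
  have hM2 : 2 ≤ L ^ i.kk * cvM d L i.m i.kk hL μ := by
    rw [show cvM d L i.m i.kk hL μ = 2 * L * L ^ i.m from MP_succ_eq L i.m i.kk hL μ]
    calc 2 = 1 * (2 * 1 * 1) := by norm_num
      _ ≤ L ^ i.kk * (2 * L * L ^ i.m) := Nat.mul_le_mul (Nat.one_le_pow _ _ hLpos) (Nat.mul_le_mul (Nat.mul_le_mul_left 2 hLpos) (Nat.one_le_pow _ _ hLpos))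
  exact (norm_holPath_two_grid_le (cvM d L i.m i.kk hL) i.kk i.r hrA0 hr1 hAop hstep hskew x' μ hs hj hδ' hM2 hπ).trans (hol_rhs_le hLpos i.r i.kk d hrA0)

end HolFit

/-! ## §3 ★★ The two comparison rows -/

section Rows

open scoped Matrix.Norms.L2Operator

variable [Nonempty mm]

/-- The transport-size constant `K_S = (d+2)·C_T·e·e^{(d+2)·C_T·e}` ((Q-6a)'s `transport_size_le` with `C = C_T`; `K_Q(ρ) = K_S·e^{ρ}`). [bookkeeping] -/
noncomputable def kS : ℝ := (d + 2 : ℝ) * cT mm ι e * Real.exp 1 * Real.exp ((d + 2 : ℝ) * cT mm ι e * Real.exp 1)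

omit [DecidableEq mm] [DecidableEq ι] in
/-- `0 ≤ K_S`. [bookkeeping] -/
theorem kS_nonneg : 0 ≤ kS d mm ι e := by unfold kS; have := cT_nonneg mm ι e; positivity

/-- The comparison constant `K_C(ρ) = (C_T·C_hol + 2K_S)·e^{ρ}`. [bookkeeping] -/
noncomputable def kC (ρ : ℝ) : ℝ := (cT mm ι e * cHol d + 2 * kS d mm ι e) * Real.exp ρ

omit [DecidableEq mm] [DecidableEq ι] in
/-- `0 ≤ K_C`. [bookkeeping] -/
theorem kC_nonneg (ρ : ℝ) : 0 ≤ kC d mm ι e ρ := by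
  unfold kC; have := cT_nonneg mm ι e; have := cHol_nonneg d; have := kS_nonneg d mm ι e; positivity

/-- ★★ **COMPARISON ROW OF THE AVERAGE SHAPE**: under `Reg335 c₃₅ α₀ A′` with `c₃₅L^mα₀ ≤ 1`, `D_f(A′)∘P̂ − D_c(A′) ≤ K_C(ρ)·(c₃₅L^mα₀)·L^{−kk}·e^{−ρd}` blockwise (coarse coloured 1-forms
→ unit lattice), every `ρ ≥ 0`: `D_f∘P̂ − D_c = (Q′_{T_f} − Q′_1)∘P̂ − (Q_{T_c} − Q_1)` is 184a's two-grid difference of the kernel averages with kernels `cvaPath T − 1`, whose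
rows are `≤ (1+ρ_T)^{(d+2)L^kk} − 1 ≤ K_S·r_A` and which FIT along King's pairing by 187b's `cv_fit_of_hol` fed with §2's holonomy fit.
[cite: Balaban1985BackgroundPropagators, (3.73) p.405, (3.81) p.406 (shape); King1986, Prop. 3.9 (3.73) p.665] -/
theorem hasMaj_qDf_pull_sub_qDc (hL : Odd L ∧ 1 < L) {c35 : ℝ} (hc35 : 0 ≤ c35) {ρ : ℝ} (hρ : 0 ≤ ρ) (i : SfIdx d L) {α₀ : ℝ} (hα₀ : 0 < α₀)
    (hr1 : c35 * (L : ℝ) ^ i.m * α₀ ≤ 1) {A' : Fin (d + 1) → CvX' d L i.m i.kk i.r hL → Matrix mm mm ℂ} (hA' : (sfInstance d mm ι hL i).Bf.Reg335 c35 α₀ A') :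
    HasMaj (CvNorm d L i.m i.kk hL ι) (BlockNorm.ofBlocks (unitTorusGeo L i.kk (cvM d L i.m i.kk hL)) (liftBlk (fun b : Tor (cvM d L i.m i.kk hL) × Fin (d + 1) => b.1) ι))
      (qDf d mm ι e hL i A' ∘ₗ pull (liftMap (kingPrV L i.kk i.r (cvM d L i.m i.kk hL)) ι) - qDc d mm ι e hL i A')
      (fun y y' => kC d mm ι e ρ * ((c35 * (L : ℝ) ^ i.m * α₀) * ((((L ^ i.kk : ℕ) : ℝ))⁻¹)) * Real.exp (-(ρ * (unitTorusGeo L i.kk (cvM d L i.m i.kk hL)).dist y y'))) := by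
  have hLpos : 0 < L := Nat.pos_of_ne_zero (NeZero.ne L)
  obtain ⟨hskew, h1, -, -⟩ := (sfInstance_reg335_iff d mm ι hL i c35 α₀ A').1 hA'
  have hrA0 : 0 ≤ c35 * (L : ℝ) ^ i.m * α₀ := by positivity
  have hκ := @basisConst_nonneg ι _ (Matrix mm mm ℂ) Matrix.frobeniusNormedAddCommGroup Matrix.frobeniusNormedSpace e
  -- the holonomy fit and the unitarity of both transporter fields (before any `set`)
  have hhol := fun x' μ s j δ' hs hj hδ' hπ => hol_fit d mm ι hL i hc35 hα₀ hr1 hA' x' μ s j δ' hs hj hδ' hπ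
  have hAm : ∀ μ x, (gavgM (Matrix mm mm ℂ) (Fin (d + 1)) (kingPrV L i.kk i.r (cvM d L i.m i.kk hL)) A' μ x)ᴴ = -gavgM (Matrix mm mm ℂ) (Fin (d + 1)) (kingPrV L i.kk i.r (cvM d L i.m i.kk hL)) A' μ x :=
    gavgM_conjTranspose_of_skew (kingPrV L i.kk i.r (cvM d L i.m i.kk hL)) hskew
  have hU'u : ∀ μ (p : CvX' d L i.m i.kk i.r hL), (NormedSpace.exp (((((L ^ i.r * L ^ i.kk : ℕ) : ℝ))⁻¹) • A' μ p))ᴴ * NormedSpace.exp (((((L ^ i.r * L ^ i.kk : ℕ) : ℝ))⁻¹) • A' μ p) = 1 :=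
    fun μ p => exp_smul_unitary_of_conjTranspose (hskew μ p) _
  have hUu : ∀ μ (p : CvX d L i.m i.kk hL), (NormedSpace.exp (((((L ^ i.kk : ℕ) : ℝ))⁻¹) • gavgM (Matrix mm mm ℂ) (Fin (d + 1)) (kingPrV L i.kk i.r (cvM d L i.m i.kk hL)) A' μ p))ᴴ *
      NormedSpace.exp (((((L ^ i.kk : ℕ) : ℝ))⁻¹) • gavgM (Matrix mm mm ℂ) (Fin (d + 1)) (kingPrV L i.kk i.r (cvM d L i.m i.kk hL)) A' μ p) = 1 :=
    fun μ p => exp_smul_unitary_of_conjTranspose (hAm μ p) _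
  -- the coarse transporters' row size
  set rA : ℝ := c35 * (L : ℝ) ^ i.m * α₀ with hrA
  set η : ℝ := ((((L ^ i.kk : ℕ) : ℝ))⁻¹) with hη
  have hη0 : 0 ≤ η := by positivity
  have hnη : ((L ^ i.kk : ℕ) : ℝ) * η = 1 := mul_inv_cancel₀ (by exact_mod_cast (pow_pos hLpos _).ne')
  have hη1 : η ≤ 1 := inv_le_one_of_one_le₀ (by exact_mod_cast Nat.one_le_pow _ _ hLpos)
  have hAnOp : ∀ μ x, ‖gavgM (Matrix mm mm ℂ) (Fin (d + 1)) (kingPrV L i.kk i.r (cvM d L i.m i.kk hL)) A' μ x‖ ≤ rA :=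
    fun μ x => (l2_opNorm_le_frobeniusNorm _).trans (norm_gavgM_le_of_norm_le d mm hL i hrA0 h1 μ x)
  have hT : ∀ μ p ii, ∑ j, |(qTc d mm ι e hL i A' μ p - 1) ii j| ≤ cT mm ι e * (Real.exp (η * rA) - 1) := fun μ p ii =>
    (sf_rows_cvT_exp_sub_one_le e hη0 hAm hAnOp μ p ii).trans (le_of_eq (by unfold cT; ring))
  have hρT0 : 0 ≤ cT mm ι e * (Real.exp (η * rA) - 1) :=
    mul_nonneg (cT_nonneg mm ι e) (by have := Real.add_one_le_exp (η * rA); nlinarith [mul_nonneg hη0 hrA0])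
  have hB := transport_size_le (d := d) (n := L ^ i.kk) (cT_nonneg mm ι e) hη0 hη1 hrA0 hr1 hnη hρT0 le_rfl
  have hB0 : 0 ≤ (1 + cT mm ι e * (Real.exp (η * rA) - 1)) ^ ((d + 2) * L ^ i.kk) - 1 := by
    have := one_le_pow₀ (M₀ := ℝ) (a := 1 + cT mm ι e * (Real.exp (η * rA) - 1)) (by linarith) (n := (d + 2) * L ^ i.kk); linarith
  have hφ0 : 0 ≤ Fintype.card ι * (@basisConst ι _ (Matrix mm mm ℂ) Matrix.frobeniusNormedAddCommGroup Matrix.frobeniusNormedSpace e * (2 * Real.sqrt (Fintype.card mm)) *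
      (Real.sqrt (Fintype.card mm) * (cHol d * (rA * η)))) := by
    have := cHol_nonneg d; positivity
  rw [qDf_eq, qDc_eq, qvCov_sub_qvCov_one, qvCov_sub_qvCov_one]
  refine (hasMaj_qvKer_twoGrid (cvM d L i.m i.kk hL) i.kk i.r hB0 hφ0 hρ
    (fun p s hs ii => rows_cvaPath_sub_one_le (cvM d L i.m i.kk hL) (L ^ i.kk) hρT0 hT p hs ii)
    (fun x' μ s j δ' hs hj hδ' hπ ii => ?_)).mono fun y y' => ?_
  · rw [sub_sub_sub_cancel_right]
    exact cv_fit_of_hol e i.m i.kk i.r hL hUu hU'u hhol x' μ s j δ' hs hj hδ' hπ ii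
  · refine mul_le_mul_of_nonneg_right ?_ (Real.exp_nonneg _)
    have h2B : 2 * ((1 + cT mm ι e * (Real.exp (η * rA) - 1)) ^ ((d + 2) * L ^ i.kk) - 1) * η ≤ 2 * (kS d mm ι e * rA) * η :=
      mul_le_mul_of_nonneg_right (mul_le_mul_of_nonneg_left (hB.trans (le_of_eq (by unfold kS; ring))) zero_le_two) hη0
    have hsum : Fintype.card ι * (@basisConst ι _ (Matrix mm mm ℂ) Matrix.frobeniusNormedAddCommGroup Matrix.frobeniusNormedSpace e * (2 * Real.sqrt (Fintype.card mm)) *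
          (Real.sqrt (Fintype.card mm) * (cHol d * (rA * η)))) +
        2 * ((1 + cT mm ι e * (Real.exp (η * rA) - 1)) ^ ((d + 2) * L ^ i.kk) - 1) / ((L ^ i.kk : ℕ) : ℝ) ≤ (cT mm ι e * cHol d + 2 * kS d mm ι e) * (rA * η) := by
      rw [div_eq_mul_inv, ← hη]
      calc _ = cT mm ι e * cHol d * (rA * η) + 2 * ((1 + cT mm ι e * (Real.exp (η * rA) - 1)) ^ ((d + 2) * L ^ i.kk) - 1) * η := by unfold cT; ring
        _ ≤ cT mm ι e * cHol d * (rA * η) + 2 * (kS d mm ι e * rA) * η := add_le_add le_rfl h2B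
        _ = _ := by ring
    calc _ ≤ ((cT mm ι e * cHol d + 2 * kS d mm ι e) * (rA * η)) * Real.exp ρ := mul_le_mul_of_nonneg_right hsum (Real.exp_nonneg _)
      _ = kC d mm ι e ρ * (rA * η) := by unfold kC; ring

/-- ★★ **COMPARISON ROW OF THE ADJOINT SHAPE**: under `Reg335 c₃₅ α₀ A′` with `c₃₅L^mα₀ ≤ 1`, `E_f(A′) − P̂∘E_c(A′) ≤ K_C(ρ)·(c₃₅L^mα₀)·L^{−kk}·e^{−ρd}` blockwise (unit lattice →
fine coloured 1-forms), every `ρ ≥ 0`: 184b's two-grid difference of the adjoint stencils with kernels `cvaPath T − 1` (columns `≤ K_S·r_A`), fitting along the backward pairing by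
187b's `cv_fitA_of_hol` fed with §2's holonomy fit. [cite: Balaban1985BackgroundPropagators, (3.73) p.405, (3.80) p.406 (shape `F*₂`); King1986, Prop. 3.9 (3.73) p.665] -/
theorem hasMaj_qEf_sub_pull_qEc (hL : Odd L ∧ 1 < L) {c35 : ℝ} (hc35 : 0 ≤ c35) {ρ : ℝ} (hρ : 0 ≤ ρ) (i : SfIdx d L) {α₀ : ℝ} (hα₀ : 0 < α₀)
    (hr1 : c35 * (L : ℝ) ^ i.m * α₀ ≤ 1) {A' : Fin (d + 1) → CvX' d L i.m i.kk i.r hL → Matrix mm mm ℂ} (hA' : (sfInstance d mm ι hL i).Bf.Reg335 c35 α₀ A') :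
    HasMaj (BlockNorm.ofBlocks (unitTorusGeo L i.kk (cvM d L i.m i.kk hL)) (liftBlk (fun b : Tor (cvM d L i.m i.kk hL) × Fin (d + 1) => b.1) ι))
      (BlockNorm.ofBlocks (unitTorusGeo L i.kk (cvM d L i.m i.kk hL)) (liftBlk (fun b : CvX' d L i.m i.kk i.r hL => blockOf (L ^ i.r * L ^ i.kk) (cvM d L i.m i.kk hL) b.1) ι))
      (qEf d mm ι e hL i A' - pull (liftMap (kingPrV L i.kk i.r (cvM d L i.m i.kk hL)) ι) ∘ₗ qEc d mm ι e hL i A')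
      (fun y y' => kC d mm ι e ρ * ((c35 * (L : ℝ) ^ i.m * α₀) * ((((L ^ i.kk : ℕ) : ℝ))⁻¹)) * Real.exp (-(ρ * (unitTorusGeo L i.kk (cvM d L i.m i.kk hL)).dist y y'))) := by
  have hLpos : 0 < L := Nat.pos_of_ne_zero (NeZero.ne L)
  obtain ⟨hskew, h1, -, -⟩ := (sfInstance_reg335_iff d mm ι hL i c35 α₀ A').1 hA'
  have hrA0 : 0 ≤ c35 * (L : ℝ) ^ i.m * α₀ := by positivity
  have hκ := @basisConst_nonneg ι _ (Matrix mm mm ℂ) Matrix.frobeniusNormedAddCommGroup Matrix.frobeniusNormedSpace e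
  have hhol := fun x' μ s j δ' hs hj hδ' hπ => hol_fit d mm ι hL i hc35 hα₀ hr1 hA' x' μ s j δ' hs hj hδ' hπ
  have hAm : ∀ μ x, (gavgM (Matrix mm mm ℂ) (Fin (d + 1)) (kingPrV L i.kk i.r (cvM d L i.m i.kk hL)) A' μ x)ᴴ = -gavgM (Matrix mm mm ℂ) (Fin (d + 1)) (kingPrV L i.kk i.r (cvM d L i.m i.kk hL)) A' μ x :=
    gavgM_conjTranspose_of_skew (kingPrV L i.kk i.r (cvM d L i.m i.kk hL)) hskew
  have hU'u : ∀ μ (p : CvX' d L i.m i.kk i.r hL), (NormedSpace.exp (((((L ^ i.r * L ^ i.kk : ℕ) : ℝ))⁻¹) • A' μ p))ᴴ * NormedSpace.exp (((((L ^ i.r * L ^ i.kk : ℕ) : ℝ))⁻¹) • A' μ p) = 1 :=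
    fun μ p => exp_smul_unitary_of_conjTranspose (hskew μ p) _
  have hUu : ∀ μ (p : CvX d L i.m i.kk hL), (NormedSpace.exp (((((L ^ i.kk : ℕ) : ℝ))⁻¹) • gavgM (Matrix mm mm ℂ) (Fin (d + 1)) (kingPrV L i.kk i.r (cvM d L i.m i.kk hL)) A' μ p))ᴴ *
      NormedSpace.exp (((((L ^ i.kk : ℕ) : ℝ))⁻¹) • gavgM (Matrix mm mm ℂ) (Fin (d + 1)) (kingPrV L i.kk i.r (cvM d L i.m i.kk hL)) A' μ p) = 1 :=
    fun μ p => exp_smul_unitary_of_conjTranspose (hAm μ p) _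
  set rA : ℝ := c35 * (L : ℝ) ^ i.m * α₀ with hrA
  set η : ℝ := ((((L ^ i.kk : ℕ) : ℝ))⁻¹) with hη
  have hη0 : 0 ≤ η := by positivity
  have hnη : ((L ^ i.kk : ℕ) : ℝ) * η = 1 := mul_inv_cancel₀ (by exact_mod_cast (pow_pos hLpos _).ne')
  have hη1 : η ≤ 1 := inv_le_one_of_one_le₀ (by exact_mod_cast Nat.one_le_pow _ _ hLpos)
  have hAnOp : ∀ μ x, ‖gavgM (Matrix mm mm ℂ) (Fin (d + 1)) (kingPrV L i.kk i.r (cvM d L i.m i.kk hL)) A' μ x‖ ≤ rA :=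
    fun μ x => (l2_opNorm_le_frobeniusNorm _).trans (norm_gavgM_le_of_norm_le d mm hL i hrA0 h1 μ x)
  have hT : ∀ μ p jj, ∑ ii, |(qTc d mm ι e hL i A' μ p - 1) ii jj| ≤ cT mm ι e * (Real.exp (η * rA) - 1) := fun μ p jj =>
    (sf_cols_cvT_exp_sub_one_le e hη0 hAm hAnOp μ p jj).trans (le_of_eq (by unfold cT; ring))
  have hρT0 : 0 ≤ cT mm ι e * (Real.exp (η * rA) - 1) :=
    mul_nonneg (cT_nonneg mm ι e) (by have := Real.add_one_le_exp (η * rA); nlinarith [mul_nonneg hη0 hrA0])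
  have hB := transport_size_le (d := d) (n := L ^ i.kk) (cT_nonneg mm ι e) hη0 hη1 hrA0 hr1 hnη hρT0 le_rfl
  have hB0 : 0 ≤ (1 + cT mm ι e * (Real.exp (η * rA) - 1)) ^ ((d + 2) * L ^ i.kk) - 1 := by
    have := one_le_pow₀ (M₀ := ℝ) (a := 1 + cT mm ι e * (Real.exp (η * rA) - 1)) (by linarith) (n := (d + 2) * L ^ i.kk); linarith
  have hφ0 : 0 ≤ Fintype.card ι * (@basisConst ι _ (Matrix mm mm ℂ) Matrix.frobeniusNormedAddCommGroup Matrix.frobeniusNormedSpace e * (2 * Real.sqrt (Fintype.card mm)) *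
      (Real.sqrt (Fintype.card mm) * (cHol d * (rA * η)))) := by
    have := cHol_nonneg d; positivity
  rw [qEf_eq, qEc_eq, qvCovAdj_sub_qvCovAdj_one, qvCovAdj_sub_qvCovAdj_one]
  refine (hasMaj_qvAdjKer_twoGrid (cvM d L i.m i.kk hL) i.kk i.r hB0 hφ0 hρ
    (fun p s hs c => cols_cvaPath_sub_one_le (cvM d L i.m i.kk hL) (L ^ i.kk) hρT0 hT p hs c)
    (fun x' κ s j δ' hs hj hδ' hπ c => ?_)).mono fun y y' => ?_
  · rw [sub_sub_sub_cancel_right]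
    exact cv_fitA_of_hol e i.m i.kk i.r hL hUu hU'u hhol x' κ s j δ' hs hj hδ' hπ c
  · refine mul_le_mul_of_nonneg_right ?_ (Real.exp_nonneg _)
    have h2B : 2 * ((1 + cT mm ι e * (Real.exp (η * rA) - 1)) ^ ((d + 2) * L ^ i.kk) - 1) * η ≤ 2 * (kS d mm ι e * rA) * η :=
      mul_le_mul_of_nonneg_right (mul_le_mul_of_nonneg_left (hB.trans (le_of_eq (by unfold kS; ring))) zero_le_two) hη0
    have hsum : Fintype.card ι * (@basisConst ι _ (Matrix mm mm ℂ) Matrix.frobeniusNormedAddCommGroup Matrix.frobeniusNormedSpace e * (2 * Real.sqrt (Fintype.card mm)) *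
          (Real.sqrt (Fintype.card mm) * (cHol d * (rA * η)))) +
        2 * ((1 + cT mm ι e * (Real.exp (η * rA) - 1)) ^ ((d + 2) * L ^ i.kk) - 1) / ((L ^ i.kk : ℕ) : ℝ) ≤ (cT mm ι e * cHol d + 2 * kS d mm ι e) * (rA * η) := by
      rw [div_eq_mul_inv, ← hη]
      calc _ = cT mm ι e * cHol d * (rA * η) + 2 * ((1 + cT mm ι e * (Real.exp (η * rA) - 1)) ^ ((d + 2) * L ^ i.kk) - 1) * η := by unfold cT; ring
        _ ≤ cT mm ι e * cHol d * (rA * η) + 2 * (kS d mm ι e * rA) * η := add_le_add le_rfl h2B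
        _ = _ := by ring
    calc _ ≤ ((cT mm ι e * cHol d + 2 * kS d mm ι e) * (rA * η)) * Real.exp ρ := mul_le_mul_of_nonneg_right hsum (Real.exp_nonneg _)
      _ = kC d mm ι e ρ * (rA * η) := by unfold kC; ring

end Rows

/-! ## §4 ★★★ The whole `hfam` for the constructed family -/

section Fam

open scoped Matrix.Norms.L2Operator

variable [Nonempty mm]

/-- ★★★ **THE SIX DISPLAYED ROWS OF (Q-3)'s `hfam` HOLD FOR THE CONSTRUCTED COVARIANT-AVERAGING FAMILY `(D_c, E_c, D_f, E_f) = (qDc, qEc, qDf, qEf)`**: for every rate `ρ > 0`, with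
`K_D := max (K_Q ρ) (K_C ρ)` (INDEPENDENT of the index `i`) and the window `s₀ := 1`, every `i`, every `α₀ > 0` with `c₃₅L^mα₀ ≤ 1` and every `A′ ∈ Reg335 c₃₅ α₀`: the four sizes
((Q-6a)) and the two comparisons (§3; `r_A·L^{−kk} ≤ (L^{kk})^{−1∕16}`). [cite: Balaban1985BackgroundPropagators, (3.80)–(3.81) p.406 (shape); Balaban1985Averaging, (124)–(126) p.36] -/
theorem qvCov_rows_sf (hL : Odd L ∧ 1 < L) {c35 : ℝ} (hc35 : 0 ≤ c35) :
    ∀ ρ : ℝ, 0 < ρ → ∃ KD s₀ : ℝ, 0 ≤ KD ∧ 0 < s₀ ∧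
      ∀ (i : SfIdx d L) (α₀ : ℝ) (A' : Fin (d + 1) → CvX' d L i.m i.kk i.r hL → Matrix mm mm ℂ), 0 < α₀ → c35 * (L : ℝ) ^ i.m * α₀ ≤ s₀ → (sfInstance d mm ι hL i).Bf.Reg335 c35 α₀ A' →
        HasMaj (CvNorm d L i.m i.kk hL ι) (BlockNorm.ofBlocks (unitTorusGeo L i.kk (cvM d L i.m i.kk hL)) (liftBlk (fun b : Tor (cvM d L i.m i.kk hL) × Fin (d + 1) => b.1) ι)) (qDc d mm ι e hL i A')
          (fun y y' => KD * (c35 * (L : ℝ) ^ i.m * α₀) * Real.exp (-(ρ * (unitTorusGeo L i.kk (cvM d L i.m i.kk hL)).dist y y'))) ∧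
        HasMaj (BlockNorm.ofBlocks (unitTorusGeo L i.kk (cvM d L i.m i.kk hL)) (liftBlk (fun b : CvX' d L i.m i.kk i.r hL => blockOf (L ^ i.r * L ^ i.kk) (cvM d L i.m i.kk hL) b.1) ι))
          (BlockNorm.ofBlocks (unitTorusGeo L i.kk (cvM d L i.m i.kk hL)) (liftBlk (fun b : Tor (cvM d L i.m i.kk hL) × Fin (d + 1) => b.1) ι)) (qDf d mm ι e hL i A')
          (fun y y' => KD * (c35 * (L : ℝ) ^ i.m * α₀) * Real.exp (-(ρ * (unitTorusGeo L i.kk (cvM d L i.m i.kk hL)).dist y y'))) ∧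
        HasMaj (BlockNorm.ofBlocks (unitTorusGeo L i.kk (cvM d L i.m i.kk hL)) (liftBlk (fun b : Tor (cvM d L i.m i.kk hL) × Fin (d + 1) => b.1) ι)) (CvNorm d L i.m i.kk hL ι) (qEc d mm ι e hL i A')
          (fun y y' => KD * (c35 * (L : ℝ) ^ i.m * α₀) * Real.exp (-(ρ * (unitTorusGeo L i.kk (cvM d L i.m i.kk hL)).dist y y'))) ∧
        HasMaj (BlockNorm.ofBlocks (unitTorusGeo L i.kk (cvM d L i.m i.kk hL)) (liftBlk (fun b : Tor (cvM d L i.m i.kk hL) × Fin (d + 1) => b.1) ι))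
          (BlockNorm.ofBlocks (unitTorusGeo L i.kk (cvM d L i.m i.kk hL)) (liftBlk (fun b : CvX' d L i.m i.kk i.r hL => blockOf (L ^ i.r * L ^ i.kk) (cvM d L i.m i.kk hL) b.1) ι)) (qEf d mm ι e hL i A')
          (fun y y' => KD * (c35 * (L : ℝ) ^ i.m * α₀) * Real.exp (-(ρ * (unitTorusGeo L i.kk (cvM d L i.m i.kk hL)).dist y y'))) ∧
        HasMaj (CvNorm d L i.m i.kk hL ι) (BlockNorm.ofBlocks (unitTorusGeo L i.kk (cvM d L i.m i.kk hL)) (liftBlk (fun b : Tor (cvM d L i.m i.kk hL) × Fin (d + 1) => b.1) ι))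
          (qDf d mm ι e hL i A' ∘ₗ pull (liftMap (kingPrV L i.kk i.r (cvM d L i.m i.kk hL)) ι) - qDc d mm ι e hL i A')
          (fun y y' => KD * ((((L ^ i.kk : ℕ) : ℝ)) ^ (-(1 / 16 : ℝ))) * Real.exp (-(ρ * (unitTorusGeo L i.kk (cvM d L i.m i.kk hL)).dist y y'))) ∧
        HasMaj (BlockNorm.ofBlocks (unitTorusGeo L i.kk (cvM d L i.m i.kk hL)) (liftBlk (fun b : Tor (cvM d L i.m i.kk hL) × Fin (d + 1) => b.1) ι))
          (BlockNorm.ofBlocks (unitTorusGeo L i.kk (cvM d L i.m i.kk hL)) (liftBlk (fun b : CvX' d L i.m i.kk i.r hL => blockOf (L ^ i.r * L ^ i.kk) (cvM d L i.m i.kk hL) b.1) ι))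
          (qEf d mm ι e hL i A' - pull (liftMap (kingPrV L i.kk i.r (cvM d L i.m i.kk hL)) ι) ∘ₗ qEc d mm ι e hL i A')
          (fun y y' => KD * ((((L ^ i.kk : ℕ) : ℝ)) ^ (-(1 / 16 : ℝ))) * Real.exp (-(ρ * (unitTorusGeo L i.kk (cvM d L i.m i.kk hL)).dist y y'))) := by
  intro ρ hρ
  refine ⟨max (kQ d mm ι e ρ) (kC d mm ι e ρ), 1, le_max_of_le_left (kQ_nonneg d mm ι e ρ), one_pos, fun i α₀ A' hα₀ hr1 hA' => ?_⟩
  have hLpos : 0 < L := Nat.pos_of_ne_zero (NeZero.ne L)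
  have hrA0 : 0 ≤ c35 * (L : ℝ) ^ i.m * α₀ := by positivity
  have hk1 : (1 : ℝ) ≤ ((L ^ i.kk : ℕ) : ℝ) := by exact_mod_cast Nat.one_le_pow _ _ hLpos
  have hK0 : 0 ≤ max (kQ d mm ι e ρ) (kC d mm ι e ρ) := le_max_of_le_left (kQ_nonneg d mm ι e ρ)
  have hcmp : (c35 * (L : ℝ) ^ i.m * α₀) * ((((L ^ i.kk : ℕ) : ℝ))⁻¹) ≤ (((L ^ i.kk : ℕ) : ℝ)) ^ (-(1 / 16 : ℝ)) := by
    calc (c35 * (L : ℝ) ^ i.m * α₀) * ((((L ^ i.kk : ℕ) : ℝ))⁻¹) ≤ 1 * ((((L ^ i.kk : ℕ) : ℝ))⁻¹) := mul_le_mul_of_nonneg_right hr1 (by positivity)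
      _ = (((L ^ i.kk : ℕ) : ℝ)) ^ (-1 : ℝ) := by rw [one_mul, Real.rpow_neg_one]
      _ ≤ (((L ^ i.kk : ℕ) : ℝ)) ^ (-(1 / 16 : ℝ)) := Real.rpow_le_rpow_of_exponent_le hk1 (by norm_num)
  have hsz : kQ d mm ι e ρ * (c35 * (L : ℝ) ^ i.m * α₀) ≤ max (kQ d mm ι e ρ) (kC d mm ι e ρ) * (c35 * (L : ℝ) ^ i.m * α₀) :=
    mul_le_mul_of_nonneg_right (le_max_left _ _) hrA0
  have hcp : kC d mm ι e ρ * ((c35 * (L : ℝ) ^ i.m * α₀) * ((((L ^ i.kk : ℕ) : ℝ))⁻¹)) ≤ max (kQ d mm ι e ρ) (kC d mm ι e ρ) * ((((L ^ i.kk : ℕ) : ℝ)) ^ (-(1 / 16 : ℝ))) :=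
    mul_le_mul (le_max_right _ _) hcmp (by positivity) hK0
  exact ⟨(hasMaj_qDc d mm ι e hL hc35 hρ.le i hα₀ hr1 hA').mono fun y y' => mul_le_mul_of_nonneg_right hsz (Real.exp_nonneg _),
    (hasMaj_qDf d mm ι e hL hc35 hρ.le i hα₀ hr1 hA').mono fun y y' => mul_le_mul_of_nonneg_right hsz (Real.exp_nonneg _),
    (hasMaj_qEc d mm ι e hL hc35 hρ.le i hα₀ hr1 hA').mono fun y y' => mul_le_mul_of_nonneg_right hsz (Real.exp_nonneg _),
    (hasMaj_qEf d mm ι e hL hc35 hρ.le i hα₀ hr1 hA').mono fun y y' => mul_le_mul_of_nonneg_right hsz (Real.exp_nonneg _),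
    (hasMaj_qDf_pull_sub_qDc d mm ι e hL hc35 hρ.le i hα₀ hr1 hA').mono fun y y' => mul_le_mul_of_nonneg_right hcp (Real.exp_nonneg _),
    (hasMaj_qEf_sub_pull_qEc d mm ι e hL hc35 hρ.le i hα₀ hr1 hA').mono fun y y' => mul_le_mul_of_nonneg_right hcp (Real.exp_nonneg _)⟩

end Fam

end Summit.QuantumFields.YangMills.BalabanUVNodes.N15.SiteLayerSf
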